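import Summits.Ventures.PercRepro.Night2LocalTwoTwoX

/-!
# PercRepro — the S6 weights at a type-`(2, 1)` flat, in `M`'s vocabulary (night-2, gen 9)

The fractional matching of NIGHT-2-local.md §19 ADDENDUM 8 (simple planes), written for the flat `G` with its
coloop `y` (`P = G ∖ {y}` the plane, `n = |P|`): a member `B` with `|G ∖ cl B| = 1` (`cl B = P`, a layer-`0`
member) puts `5/12` on `{y} ∪ B` — a `3`-element such `B` spreads `(5/12)/(n − 3)` over the sets `{y, x} ∪ B`,
a `4`-element such `B` containing a collinear triple of `m ≤ 3` puts `5/24` on `{y} ∪ B` and `(5/24)/(n − 4)` on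
each `{y, x} ∪ B`; a member with `|G ∖ cl B| = m ≥ 2` puts `(5/4)/(m + 2)` on each covering set `B ∪ {z}`.
This file fixes the interface (`s6Weight`), nonnegativity and the row sums of the members with `m ≠ 1`; the
remaining rows and the column bounds (the case analysis of ADDENDUM 8, with the counting lemmas of
`Night2LocalSimpleCount`, `…Count2`, `…Count3`, `Night2LocalPlaneFacts`) are the work left for the type `(2, 1)`.
-/

namespace PercRepro.Shadow

open Finset PerFlat ThmH

variable {α : Type*} [DecidableEq α]

open scoped Classical in
/-- The S6 weight `w(B, S)` at the flat `G` with coloop `y` (the fractional matching of the type `(2, 1)` for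
simple planes, NIGHT-2-local.md §19 ADDENDUM 8). -/
noncomputable def s6Weight (M : Matroid α) [M.Finite] (G : Finset α) (y : α) (B S : Finset α) : ℚ :=
  if (G \ clF M B).card = 1 then
    if B.card = 3 then
      (if B ⊆ S ∧ y ∈ S ∧ (S \ B).card = 2 then (5 / 12) / ((G.card - 4 : ℕ) : ℚ) else 0)
    else if B.card = 4 ∧ ∃ e ∈ B, rkN M (B.erase e) = 2 ∧ ((G.erase y) \ clF M (B.erase e)).card ≤ 3 then
      (if S = insert y B then 5 / 24 else 0) +
        (if B ⊆ S ∧ y ∈ S ∧ (S \ B).card = 2 then (5 / 24) / ((G.card - 5 : ℕ) : ℚ) else 0)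
    else (if S = insert y B then 5 / 12 else 0)
  else (if S ∈ coverSets M B G then (5 / 4) / (((G \ clF M B).card : ℚ) + 2) else 0)

variable {M : Matroid α} [M.Finite]

/-- The S6 weights are nonnegative. -/
theorem s6Weight_nonneg (G : Finset α) (y : α) (B S : Finset α) : 0 ≤ s6Weight M G y B S := by
  unfold s6Weight
  split_ifs <;> positivity

open scoped Classical in
/-- **Row sum of a member with `m ≥ 2`**: the S6 weights of a member `B` with `|G ∖ cl B| = m ≠ 1` sum to
`(5/4)·m/(m + 2)` over the shadow sets (only the `m` covering sets carry weight). -/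
theorem sum_s6Weight_of_ne_one {q : ℕ} {𝒜 : Finset (Finset α)} (h𝒜 : 𝒜 ⊆ Uq M (q + 2) q) {G : Finset α}
    (hG : G ∈ flatsQ M (q + 1)) (y : α) {B : Finset α} (hB : B ∈ membersIn M 𝒜 G)
    (hm : (G \ clF M B).card ≠ 1) :
    ∑ S ∈ shadowAt M (q + 2) q 𝒜 G, s6Weight M G y B S =
      (5 / 4) * (((G \ clF M B).card : ℚ) / (((G \ clF M B).card : ℚ) + 2)) := by
  have hBU : B ∈ Uq M (q + 2) q := h𝒜 (mem_membersIn.1 hB).1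
  have hsub := coverSets_subset_shadowAt h𝒜 hG hB
  have hrow : ∀ S ∈ shadowAt M (q + 2) q 𝒜 G, s6Weight M G y B S =
      if S ∈ coverSets M B G then (5 / 4) / (((G \ clF M B).card : ℚ) + 2) else 0 := by
    intro S _
    unfold s6Weight
    rw [if_neg hm]
  rw [Finset.sum_congr rfl hrow, ← Finset.sum_filter, Finset.filter_mem_eq_inter,
    Finset.inter_eq_right.2 hsub, Finset.sum_const, card_coverSets hBU, nsmul_eq_mul]
  field_simp

/-! ## The same weights without the coloop parameter

`s6Weight` names the coloop `y`; when `M|G` has a second coloop `y″`, the members with `cl B = G ∖ {y″}` need their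
identity set `B ∪ {y″}` instead.  `s6W` uses the unique element of `G ∖ cl B` (the covering set) throughout and
measures `m` of a collinear triple inside `cl B`, so no coloop needs to be named. -/

open scoped Classical in
/-- The S6 weight `w(B, S)` at the flat `G`, coloop-free formulation: layer-`0` members (`|G ∖ cl B| = 1`) put
`5/12` on their covering set, a `3`-element one spreads it over the sets `B ∪ (G ∖ cl B) ∪ {x}`, a `4`-element
one with a collinear triple of `m ≤ 3` (measured inside `cl B`) puts `5/24` on the covering set and spreads
`5/24`; other members put `(5/4)/(m + 2)` on each covering set. -/
noncomputable def s6W (M : Matroid α) [M.Finite] (G : Finset α) (B S : Finset α) : ℚ :=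
  if (G \ clF M B).card = 1 then
    if B.card = 3 then
      (if B ∪ (G \ clF M B) ⊆ S ∧ S ⊆ G ∧ (S \ B).card = 2 then (5 / 12) / ((G.card - 4 : ℕ) : ℚ) else 0)
    else if B.card = 4 ∧ ∃ e ∈ B, rkN M (B.erase e) = 2 ∧ (clF M B \ clF M (B.erase e)).card ≤ 3 then
      (if S ∈ coverSets M B G then 5 / 24 else 0) +
        (if B ∪ (G \ clF M B) ⊆ S ∧ S ⊆ G ∧ (S \ B).card = 2 then (5 / 24) / ((G.card - 5 : ℕ) : ℚ) else 0)
    else (if S ∈ coverSets M B G then 5 / 12 else 0)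
  else (if S ∈ coverSets M B G then (5 / 4) / (((G \ clF M B).card : ℚ) + 2) else 0)

/-- The weights `s6W` are nonnegative. -/
theorem s6W_nonneg (G : Finset α) (B S : Finset α) : 0 ≤ s6W M G B S := by
  unfold s6W
  split_ifs <;> positivity

open scoped Classical in
/-- **Row sum of a member with `m ≠ 1`** for `s6W`: exactly `(5/4)·m/(m + 2)`. -/
theorem sum_s6W_of_ne_one {q : ℕ} {𝒜 : Finset (Finset α)} (h𝒜 : 𝒜 ⊆ Uq M (q + 2) q) {G : Finset α}
    (hG : G ∈ flatsQ M (q + 1)) {B : Finset α} (hB : B ∈ membersIn M 𝒜 G) (hm : (G \ clF M B).card ≠ 1) :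
    ∑ S ∈ shadowAt M (q + 2) q 𝒜 G, s6W M G B S =
      (5 / 4) * (((G \ clF M B).card : ℚ) / (((G \ clF M B).card : ℚ) + 2)) := by
  have hBU : B ∈ Uq M (q + 2) q := h𝒜 (mem_membersIn.1 hB).1
  have hsub := coverSets_subset_shadowAt h𝒜 hG hB
  have hrow : ∀ S ∈ shadowAt M (q + 2) q 𝒜 G, s6W M G B S =
      if S ∈ coverSets M B G then (5 / 4) / (((G \ clF M B).card : ℚ) + 2) else 0 := by
    intro S _
    unfold s6W
    rw [if_neg hm]
  rw [Finset.sum_congr rfl hrow, ← Finset.sum_filter, Finset.filter_mem_eq_inter,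
    Finset.inter_eq_right.2 hsub, Finset.sum_const, card_coverSets hBU, nsmul_eq_mul]
  field_simp

open scoped Classical in
/-- **Row sum of a layer-`0` member of `≥ 5` elements** for `s6W`: exactly `5/12` (its single covering set). -/
theorem sum_s6W_of_eq_one_of_five_le {q : ℕ} {𝒜 : Finset (Finset α)} (h𝒜 : 𝒜 ⊆ Uq M (q + 2) q) {G : Finset α}
    (hG : G ∈ flatsQ M (q + 1)) {B : Finset α} (hB : B ∈ membersIn M 𝒜 G) (hm : (G \ clF M B).card = 1)
    (h5 : 5 ≤ B.card) : ∑ S ∈ shadowAt M (q + 2) q 𝒜 G, s6W M G B S = 5 / 12 := by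
  have hBU : B ∈ Uq M (q + 2) q := h𝒜 (mem_membersIn.1 hB).1
  have hsub := coverSets_subset_shadowAt h𝒜 hG hB
  have hrow : ∀ S ∈ shadowAt M (q + 2) q 𝒜 G, s6W M G B S =
      if S ∈ coverSets M B G then 5 / 12 else 0 := by
    intro S _
    unfold s6W
    rw [if_pos hm, if_neg (by omega), if_neg (by rintro ⟨h, -⟩; omega)]
  rw [Finset.sum_congr rfl hrow, ← Finset.sum_filter, Finset.filter_mem_eq_inter,
    Finset.inter_eq_right.2 hsub, Finset.sum_const, card_coverSets hBU, hm]
  simp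

end PercRepro.Shadow
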